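import Summits.QuantumFields.GaugeBoot.ZdWordLinkReflection
import Summits.QuantumFields.GaugeBoot.WordCanon
import HarnessLib

/-!
# Canonical loop classes on `ℤ^d`: the identification pipeline for translation- and `B_d`-invariant states (gauge-boot, Class-B rows 1/3)

HONEST FRAMING (cell `pub-gaugeboot`, page 1 of every file): the venture produces certified bounds
on lattice expectations at stated coupling, gauge group, dimension and torus size; NOT a mass gap,
NOT a continuum limit, NOT a string tension; NOT Yang–Mills-summit-bearing (barriers
`FixedCouplingUltralocality`, `PerturbativeInvisibility`).

`LoopClasses.lean` / `WordCanon.lean` identify raw words with canonical class labels IN EXPECTATION on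
the torus: `⟨W_0(w)⟩ = ⟨W_0(canon ms rev k₁ k₂ w)⟩` (`wilsonExpectation_wordLoop_canon`), the engine behind
the rows-as-data modules (`MMRowSU2.lean`, `KZL2D3SDRows*`, …). This file is the same pipeline for a
measure `μ` on the INFINITE lattice `ℤ^d` that is translation invariant and invariant under the axis
permutations and axis reflections (the invariance axioms of `ClassBState`), with the loop variable
`∫ wordLoopZd ρ 0 w dμ` (`ClassBWords.lean`); the combinatorial objects (`Word.disp`, `Word.freeReduce`,
`Move`, `Word.acts`, `Word.canon`, `Word.canonW`) are those of `LoopClasses.lean` / `WordCanon.lean`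
verbatim:

* pointwise: `endpointZd_eq_add_disp`, `wordHolonomyZd_freeReduce`, `wordLoopZd_freeReduce`,
  `wordLoopZd_reverse`, `wordLoopZd_rotate` (cyclic rotation = base-point shift), `Step.reflectAxis_eq_flipAt`;
* integrated: `integral_wordLoopZd_add` (translations), `integral_wordLoopZd_rotateN`,
  `integral_wordLoopZd_act` / `_acts` (hyperoctahedral moves at the origin), the master lemma
  **`integral_wordLoopZd_canon`** and, in `d = 3`, **`integral_wordLoopZd_canonW`** (every witness code);
* **`ClassBState.integral_wordLoopZd_canonW`** — for a Class-B state every closed word has the loop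
  expectation of its canonical label, for EVERY untrusted witness code (soundness never depends on the
  code).

Everything is `[folklore]`.
-/

noncomputable section

open MeasureTheory
open scoped Matrix
open Literature.Probability.LatticeModels (Site)
open Literature.MathematicalPhysics.QuantumLattice (LGConfig ZdEdge configShift IsZdTranslationInvariant)
open Literature.RepresentationTheory.CompactGroups

namespace Summit.QuantumFields.GaugeBoot

variable {d N : ℕ} {G : Type*} [Group G]

/-! ### Pointwise facts -/

section Pointwise

/-- On `ℤ^d` the endpoint is the base point plus the net displacement, exactly. [folklore] -/
theorem endpointZd_eq_add_disp (x : Site d) : ∀ w : Word d, Word.endpointZd x w = x + Word.disp w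
  | [] => by simp
  | s :: w => by
    rw [Word.endpointZd_cons, endpointZd_eq_add_disp (s.applyZd x) w, Word.disp_cons, ← add_assoc]
    cases s <;> simp [Step.applyZd, Step.disp, sub_eq_add_neg]

/-- A word with zero net displacement is closed at every base point of `ℤ^d`. [folklore] -/
theorem endpointZd_eq_self_of_disp (x : Site d) {w : Word d} (hw : Word.disp w = 0) :
    Word.endpointZd x w = x := by
  rw [endpointZd_eq_add_disp, hw, add_zero]

/-- One step of free reduction through the `ℤ^d` holonomy. [folklore] -/
theorem wordHolonomyZd_freeReduce_cons (U : LGConfig d G) (x : Site d) (s : Step d) (w : Word d) :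
    wordHolonomyZd U x (Word.freeReduce (s :: w)) =
      stepHolonomyZd U x s * wordHolonomyZd U (s.applyZd x) (Word.freeReduce w) := by
  cases hfw : Word.freeReduce w with
  | nil => simp [Word.freeReduce, hfw]
  | cons t v =>
    by_cases ht : t = s.inv
    · subst ht
      simp only [Word.freeReduce, hfw, ↓reduceIte, wordHolonomyZd_cons, stepHolonomyZd_applyZd_inv,
        Step.applyZd_inv_applyZd, ← mul_assoc, mul_inv_cancel, one_mul]
    · simp only [Word.freeReduce, hfw, ht, ↓reduceIte, wordHolonomyZd_cons]

/-- **Free reduction preserves the `ℤ^d` holonomy.** [folklore] -/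
theorem wordHolonomyZd_freeReduce (U : LGConfig d G) :
    ∀ (w : Word d) (x : Site d), wordHolonomyZd U x (Word.freeReduce w) = wordHolonomyZd U x w
  | [], _ => rfl
  | s :: w, x => by
    rw [wordHolonomyZd_freeReduce_cons, wordHolonomyZd_freeReduce U w (s.applyZd x), wordHolonomyZd_cons]

variable (ρ : G →* Matrix (Fin N) (Fin N) ℂ)

/-- Free reduction does not change the `ℤ^d` loop variable. [folklore] -/
theorem wordLoopZd_freeReduce (x : Site d) (w : Word d) :
    wordLoopZd ρ x (Word.freeReduce w) = wordLoopZd (G := G) ρ x w := by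
  funext U
  simp only [wordLoopZd_apply, wordHolonomyZd_freeReduce]

variable [TopologicalSpace G] [IsTopologicalGroup G] [CompactSpace G]

/-- Reversal of a CLOSED word does not change the `ℤ^d` loop variable (`Re tr ρ(h⁻¹) = Re tr ρ(h)`).
[folklore] -/
theorem wordLoopZd_reverse (hρ : Continuous ρ) (x : Site d) (w : Word d) (hw : Word.endpointZd x w = x) :
    wordLoopZd ρ x (Word.reverse w) = wordLoopZd (G := G) ρ x w := by
  funext U
  have h := wordHolonomyZd_reverse U x w
  rw [hw] at h
  simp only [wordLoopZd_apply, h, CompactGroup.re_trace_map_inv ρ hρ]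

omit [TopologicalSpace G] [IsTopologicalGroup G] [CompactSpace G] in
/-- Cyclic rotation of a CLOSED word = moving the base point along its first step (cyclicity of the
trace), pointwise on `ℤ^d`. [folklore] -/
theorem wordLoopZd_rotate (x : Site d) (s : Step d) (w : Word d) (hw : Word.endpointZd x (s :: w) = x) :
    wordLoopZd ρ x (s :: w) = wordLoopZd (G := G) ρ (s.applyZd x) (w ++ [s]) := by
  funext U
  rw [Word.endpointZd_cons] at hw
  simp only [wordLoopZd_apply, wordHolonomyZd_cons, wordHolonomyZd_append, hw, wordHolonomyZd_nil, mul_one,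
    map_mul]
  rw [Matrix.trace_mul_comm]

omit [Group G] [TopologicalSpace G] [IsTopologicalGroup G] [CompactSpace G] in
/-- `LoopClasses`' `reflectAxis` is `PeriodicWordReflection`'s `flipAt`. [folklore] -/
theorem Step.reflectAxis_eq_flipAt (k : Fin d) (s : Step d) : s.reflectAxis k = s.flipAt k := by
  cases s <;> rfl

end Pointwise

/-! ### Integrated: translations, rotations, moves -/

section Integrated

variable [MeasurableSpace G] (ρ : G →* Matrix (Fin N) (Fin N) ℂ) {μW : Measure (LGConfig d G)}

/-- **Loop variables are translation invariant** (`wordLoopZd` form). [folklore] -/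
theorem integral_wordLoopZd_add (hT : IsZdTranslationInvariant μW) (v x : Site d) (w : Word d) :
    ∫ U, wordLoopZd ρ (x + v) w U ∂μW = ∫ U, wordLoopZd (G := G) ρ x w U ∂μW := by
  have h := integral_comp_configShift_eq hT v fun U => ((wordLoopZd (G := G) ρ (x + v) w U : ℝ) : ℂ)
  simp only [wordLoopZd_apply, wordHolonomyZd_configShift, add_sub_cancel_right] at h
  rw [integral_complex_ofReal, integral_complex_ofReal] at h
  simp only [wordLoopZd_apply]
  exact_mod_cast h.symm

/-- **`k`-fold cyclic rotation of a closed word preserves `∫ W dμ`** for a translation-invariant `μ`.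
[folklore] -/
theorem integral_wordLoopZd_rotateN (hT : IsZdTranslationInvariant μW) (x : Site d) :
    ∀ (k : ℕ) (w : Word d), Word.disp w = 0 →
      ∫ U, wordLoopZd ρ x (w.rotate k) U ∂μW = ∫ U, wordLoopZd (G := G) ρ x w U ∂μW
  | 0, w, _ => by rw [List.rotate_zero]
  | k + 1, [], _ => by rw [List.rotate_nil]
  | k + 1, s :: w, hw => by
    rw [List.rotate_cons_succ]
    have hw' : Word.disp (w ++ [s]) = 0 := by
      rw [← hw, Word.disp_append, Word.disp_cons, Word.disp_cons, Word.disp_nil]; abel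
    rw [integral_wordLoopZd_rotateN hT x k (w ++ [s]) hw',
      wordLoopZd_rotate ρ x s w (endpointZd_eq_self_of_disp x hw)]
    have e : s.applyZd x = x + Step.disp s := by cases s <;> simp [Step.applyZd, Step.disp, sub_eq_add_neg]
    rw [e, integral_wordLoopZd_add ρ hT]

variable [TopologicalSpace G] [BorelSpace G] [SecondCountableTopology G]

omit [Group G] in
/-- A continuous real function of the configuration has the same integral after a measure-preserving
map. [folklore] -/
theorem integral_comp_eq_of_measurePreserving_real {T : LGConfig d G → LGConfig d G}
    (hTm : MeasurePreserving T μW μW) (Φ : LGConfig d G → ℝ) (hΦ : Continuous Φ) :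
    ∫ U, Φ (T U) ∂μW = ∫ U, Φ U ∂μW := by
  have h := integral_comp_eq_of_measurePreserving hTm (fun U => ((Φ U : ℝ) : ℂ))
    (Complex.continuous_ofReal.comp hΦ)
  rw [integral_complex_ofReal, integral_complex_ofReal] at h
  exact_mod_cast h

variable [IsTopologicalGroup G] [NeZero d]

/-- **A hyperoctahedral move at the origin preserves `∫ W_0 dμ`** for a measure invariant under the axis
permutations and axis reflections. [folklore] -/
theorem integral_wordLoopZd_act (hρ : Continuous ρ)
    (hP : ∀ σ : Equiv.Perm (Fin d), MeasurePreserving (configPerm σ) μW μW)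
    (hR : ∀ i : Fin d, MeasurePreserving (configSiteReflect i) μW μW) (m : Move d) (w : Word d) :
    ∫ U, wordLoopZd ρ (0 : Site d) (w.map m.act) U ∂μW = ∫ U, wordLoopZd (G := G) ρ 0 w U ∂μW := by
  cases m with
  | perm π =>
    have h := integral_comp_eq_of_measurePreserving_real (hP π.symm) (wordLoopZd ρ 0 w)
      (continuous_wordLoopZd hρ 0 w)
    simp only [wordLoopZd_apply, wordHolonomyZd_configPerm, Equiv.symm_symm] at h
    have h0 : ((0 : Site d) ∘ (π.symm : Fin d → Fin d)) = 0 := rfl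
    rw [h0] at h
    simp only [wordLoopZd_apply]
    exact h
  | refl0 =>
    have h := integral_comp_eq_of_measurePreserving_real (hR 0) (wordLoopZd ρ 0 w)
      (continuous_wordLoopZd hρ 0 w)
    have h0 : zdSiteReflect (0 : Fin d) (0 : Site d) = 0 := by ext k; simp [zdSiteReflect]
    have hm : w.map (Move.refl0 : Move d).act = w.map (Step.flipAt 0) := by
      rw [show (Move.refl0 : Move d).act = Step.reflect0 from rfl, Word.map_reflect0_eq]
      exact List.map_congr_left fun s _ => Step.reflectAxis_eq_flipAt 0 s
    simp only [wordLoopZd_apply, wordHolonomyZd_configSiteReflect, h0] at h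
    rw [hm]
    simp only [wordLoopZd_apply]
    exact h
  | refl k =>
    have h := integral_comp_eq_of_measurePreserving_real (hR k) (wordLoopZd ρ 0 w)
      (continuous_wordLoopZd hρ 0 w)
    have h0 : zdSiteReflect k (0 : Site d) = 0 := by ext j; simp [zdSiteReflect]
    have hm : w.map (Move.refl k).act = w.map (Step.flipAt k) :=
      List.map_congr_left fun s _ => Step.reflectAxis_eq_flipAt k s
    simp only [wordLoopZd_apply, wordHolonomyZd_configSiteReflect, h0] at h
    rw [hm]
    simp only [wordLoopZd_apply]
    exact h

/-- **A list of moves at the origin preserves `∫ W_0 dμ`.** [folklore] -/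
theorem integral_wordLoopZd_acts (hρ : Continuous ρ)
    (hP : ∀ σ : Equiv.Perm (Fin d), MeasurePreserving (configPerm σ) μW μW)
    (hR : ∀ i : Fin d, MeasurePreserving (configSiteReflect i) μW μW) (ms : List (Move d)) (w : Word d) :
    ∫ U, wordLoopZd ρ (0 : Site d) (Word.acts ms w) U ∂μW = ∫ U, wordLoopZd (G := G) ρ 0 w U ∂μW := by
  induction ms with
  | nil => rfl
  | cons m ms ih => rw [Word.acts_cons, integral_wordLoopZd_act ρ hρ hP hR m, ih]

variable [CompactSpace G]

/-- **Master identification lemma on `ℤ^d`.** For a translation-, permutation- and reflection-invariant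
measure `μ` and a word `w` whose image under the moves `ms` is closed,
`∫ W_0(w) dμ = ∫ W_0(canon ms rev k₁ k₂ w) dμ`. [folklore] -/
theorem integral_wordLoopZd_canon (hρ : Continuous ρ) (hT : IsZdTranslationInvariant μW)
    (hP : ∀ σ : Equiv.Perm (Fin d), MeasurePreserving (configPerm σ) μW μW)
    (hR : ∀ i : Fin d, MeasurePreserving (configSiteReflect i) μW μW) (ms : List (Move d)) (rev : Bool)
    (k₁ k₂ : ℕ) (w : Word d) (hw : Word.disp (Word.acts ms w) = 0) :
    ∫ U, wordLoopZd ρ (0 : Site d) w U ∂μW =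
      ∫ U, wordLoopZd (G := G) ρ 0 (Word.canon ms rev k₁ k₂ w) U ∂μW := by
  rw [← integral_wordLoopZd_acts ρ hρ hP hR ms w]
  set v := Word.acts ms w with hv
  set v₁ := (if rev then Word.reverse v else v) with hv₁
  have hv₁d : Word.disp v₁ = 0 := by
    rw [hv₁]; split_ifs <;> simp [hw]
  have h1 : ∫ U, wordLoopZd (G := G) ρ (0 : Site d) v U ∂μW = ∫ U, wordLoopZd ρ (0 : Site d) v₁ U ∂μW := by
    rw [hv₁]
    by_cases hrev : rev
    · simp only [hrev, ↓reduceIte, wordLoopZd_reverse ρ hρ 0 v (endpointZd_eq_self_of_disp 0 hw)]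
    · simp only [hrev]
      rfl
  have h2 := integral_wordLoopZd_rotateN (G := G) ρ hT (0 : Site d) k₁ v₁ hv₁d
  have h3 : wordLoopZd ρ (0 : Site d) (Word.freeReduce (v₁.rotate k₁)) =
      wordLoopZd (G := G) ρ 0 (v₁.rotate k₁) := wordLoopZd_freeReduce ρ 0 _
  have h4 := integral_wordLoopZd_rotateN (G := G) ρ hT (0 : Site d) k₂ (Word.freeReduce (v₁.rotate k₁))
    (by simp [hv₁d])
  unfold Word.canon
  rw [← hv, ← hv₁, h4, h3, h2, h1]

end Integrated

/-! ### `d = 3`: witness codes; Class-B states -/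

section Three

variable [TopologicalSpace G] [IsTopologicalGroup G] [CompactSpace G] [MeasurableSpace G] [BorelSpace G]
  [SecondCountableTopology G] (ρ : G →* Matrix (Fin N) (Fin N) ℂ) {μW : Measure (LGConfig 3 G)}

/-- **Relabelling by ANY witness code preserves the loop variable** of an invariant measure on `ℤ³`:
`∫ W_0(w.canonW c) dμ = ∫ W_0(w) dμ` for every closed `w`. [folklore] -/
theorem integral_wordLoopZd_canonW (hρ : Continuous ρ) (hT : IsZdTranslationInvariant μW)
    (hP : ∀ σ : Equiv.Perm (Fin 3), MeasurePreserving (configPerm σ) μW μW)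
    (hR : ∀ i : Fin 3, MeasurePreserving (configSiteReflect i) μW μW) (c : ℕ) (w : Word 3)
    (hw : Word.disp w = 0) :
    ∫ U, wordLoopZd ρ (0 : Site 3) (w.canonW c) U ∂μW = ∫ U, wordLoopZd (G := G) ρ 0 w U ∂μW := by
  unfold Word.canonW
  exact (integral_wordLoopZd_canon ρ hρ hT hP hR _ _ _ _ _ (Word.disp_acts _ hw)).symm

/-- **The same from any base point** `x ∈ ℤ³` (translation invariance). [folklore] -/
theorem integral_wordLoopZd_eq_canonW_at (hρ : Continuous ρ) (hT : IsZdTranslationInvariant μW)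
    (hP : ∀ σ : Equiv.Perm (Fin 3), MeasurePreserving (configPerm σ) μW μW)
    (hR : ∀ i : Fin 3, MeasurePreserving (configSiteReflect i) μW μW) (x : Site 3) (c : ℕ) (w : Word 3)
    (hw : Word.disp w = 0) :
    ∫ U, wordLoopZd ρ x w U ∂μW = ∫ U, wordLoopZd (G := G) ρ 0 (w.canonW c) U ∂μW := by
  rw [integral_wordLoopZd_canonW ρ hρ hT hP hR c w hw, ← integral_wordLoopZd_add ρ hT x 0 w, zero_add]

/-- **Class B: every closed word has the loop expectation of its canonical label**, for every witness
code. [folklore] -/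
theorem ClassBState.integral_wordLoopZd_canonW (hρ : Continuous ρ) {β : ℝ} (ω : ClassBState 3 ρ β) (c : ℕ)
    (w : Word 3) (hw : Word.disp w = 0) :
    ∫ U, wordLoopZd ρ (0 : Site 3) (w.canonW c) U ∂ω.μ = ∫ U, wordLoopZd ρ 0 w U ∂ω.μ :=
  _root_.Summit.QuantumFields.GaugeBoot.integral_wordLoopZd_canonW ρ hρ ω.translationInvariant ω.permInvariant
    ω.reflectInvariant c w hw

end Three

end Summit.QuantumFields.GaugeBoot

end
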